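import Summits.KontsevichZagierPeriods.KontsevichZagierPeriods.Theorems.MzvKernelInKZTwoPosetsDefs
import Summits.KontsevichZagierPeriods.KontsevichZagierPeriods.Theorems.FurushoPentagonHoffmanRelationInKZCubicalTransportAux
import Literature.NumberTheory.Transcendental.NashCubes

/-!
# `MzvKernelInKZ` (stmt-KontsevichZagierPeriods-3914), two-posets-interior-landen: cubical chart

Stub `stub_cubicalChart : CubicalChart` of the lead's skeleton of the line
`two-posets-interior-landen` on the crux `LinRedNormalForm.MzvKernelInKZ`.

The monomial ("cubical", "forest") chart `tᵢ = x₀ x₁ ⋯ xᵢ` (`cubicalMap N`) maps the open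
cube `(0,1)ᴺ` bijectively onto the open ordered simplex `1 > t₀ > ⋯ > t_{N-1} > 0`
(`Negative.simplex N`), with inverse `x₀ = t₀`, `x_{i+1} = t_{i+1} / tᵢ`
(`cubicalMap_cons_div`); its Jacobian matrix is lower triangular with determinant
`∏ᵢ ∏_{l<i} x_l = ∏ⱼ xⱼ^{N-1-j} > 0` on the cube (`prod_prod_erase_filter_le`). Hence, for
admissible letters `ε`, the cubical pull-back
`cubicalFun ε q = (wordFun ε q ∘ cubicalMap N) · ∏ⱼ xⱼ^{N-1-j}` is absolutely integrable on the
cube, and every representation on the cube with that integrand differs from the word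
representation `[Δ_N, q ω_ε]` (`Negative.wordRep ε q hε`) by ONE change-of-variables move of the
Kontsevich–Zagier calculus (rule (2)): both conjuncts are read off the monomial-chart transport
theorem `FurushoPentagon.HoffmanRelationInKZ.monomialChart_transport` (rows `S i = {j ≤ i}`).

Sources: M. Kontsevich, D. Zagier, *Periods* (2001), §1.2 rule (2); I. Soudères, *Motivic double
shuffle*, Int. J. Number Theory 6 (2010), §1 (cubical coordinates); F. Brown, *Multiple zeta values
and periods of moduli spaces* (2009), §2.
-/

noncomputable section

namespace Summit.KontsevichZagierPeriods.MzvKernelInKZ.TwoPosets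

open Set MeasureTheory
open Literature.NumberTheory.Transcendental
open Summit.KontsevichZagierPeriods.MzvKernelInKZ.Negative
open Summit.KontsevichZagierPeriods.FurushoPentagon.HoffmanRelationInKZ (monomialChart_transport)

/-! ## The cubical chart: recursion, inverse, image, injectivity, Jacobian -/

section Chart

variable {N n : ℕ}

/-- The open cube of this line is the tree's open unit cube `openUnitCube` (definitional).
[folklore] -/
theorem cube_eq_openUnitCube (N : ℕ) : cube N = openUnitCube N := rfl

/-- The open cube is `ℚ`-semialgebraic. [folklore] -/
theorem isSemialgebraic_cube (N : ℕ) :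
    Literature.ModelTheory.ExponentialFields.IsSemialgebraic ℚ (cube N) := by
  rw [cube_eq_openUnitCube]
  exact isSemialgebraic_openUnitCube

/-- The components of the cubical chart are the partial products (definitional). [folklore] -/
theorem cubicalMap_apply (x : Fin N → ℝ) (i : Fin N) : cubicalMap N x i = pprod x i := rfl

/-- First partial product: `P₀(x) = x₀`. [folklore] -/
theorem pprod_zero (x : Fin (n + 1) → ℝ) : pprod x 0 = x 0 := by
  unfold pprod
  have h : Finset.univ.filter (fun j : Fin (n + 1) => j ≤ 0) = {0} := by
    ext j
    simp
  rw [h, Finset.prod_singleton]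

/-- Recursion of the partial products: `P_{j+1}(x) = P_j(x) · x_{j+1}`. [folklore] -/
theorem pprod_succ (x : Fin (n + 1) → ℝ) (j : Fin n) :
    pprod x j.succ = pprod x j.castSucc * x j.succ := by
  unfold pprod
  have h : Finset.univ.filter (fun k : Fin (n + 1) => k ≤ j.succ) =
      insert j.succ (Finset.univ.filter (fun k : Fin (n + 1) => k ≤ j.castSucc)) := by
    ext k
    simp only [Finset.mem_filter, Finset.mem_univ, true_and, Finset.mem_insert,
      Fin.le_iff_val_le_val, Fin.ext_iff, Fin.val_succ, Fin.val_castSucc]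
    omega
  have h' : j.succ ∉ Finset.univ.filter (fun k : Fin (n + 1) => k ≤ j.castSucc) := by
    simp [Fin.le_iff_val_le_val]
  rw [h, Finset.prod_insert h', mul_comm]

/-- The partial products of a vector with non-zero entries are non-zero. [folklore] -/
theorem pprod_ne_zero {x : Fin N → ℝ} (hx : ∀ i, x i ≠ 0) (i : Fin N) : pprod x i ≠ 0 :=
  Finset.prod_ne_zero_iff.mpr fun j _ => hx j

/-- The partial products of a vector with positive entries are positive. [folklore] -/
theorem pprod_pos {x : Fin N → ℝ} (hx : ∀ i, 0 < x i) (i : Fin N) : 0 < pprod x i :=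
  Finset.prod_pos fun j _ => hx j

/-- Off the coordinate hyperplanes each later coordinate is the quotient of two consecutive
partial products: `x_{j+1} = P_{j+1}(x) / P_j(x)`. [folklore] -/
theorem eq_pprod_succ_div {x : Fin (n + 1) → ℝ} (hx : ∀ i, x i ≠ 0) (j : Fin n) :
    x j.succ = pprod x j.succ / pprod x j.castSucc := by
  rw [pprod_succ, mul_div_cancel_left₀ _ (pprod_ne_zero hx _)]

/-- Telescoping: the cubical chart applied to the successive quotients
`(t₀, t₁/t₀, …, t_n/t_{n-1})` (the inverse chart) returns `t`, off the coordinate hyperplanes.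
[folklore] -/
theorem cubicalMap_cons_div {t : Fin (n + 1) → ℝ} (ht : ∀ i, t i ≠ 0) :
    cubicalMap (n + 1) (Fin.cons (t 0) fun j : Fin n => t j.succ / t j.castSucc) = t := by
  funext i
  rw [cubicalMap_apply]
  induction i using Fin.induction with
  | zero => rw [pprod_zero, Fin.cons_zero]
  | succ j ih => rw [pprod_succ, ih, Fin.cons_succ, mul_div_cancel₀ _ (ht _)]

/-- The cubical chart maps the open cube into the open ordered simplex. [folklore] -/
theorem cubicalMap_mem_simplex {x : Fin (n + 1) → ℝ} (hx : x ∈ cube (n + 1)) :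
    cubicalMap (n + 1) x ∈ simplex (n + 1) := by
  have hpos : ∀ i, 0 < pprod x i := pprod_pos fun i => (hx i).1
  refine ⟨hpos, fun i => ?_, ?_⟩
  · show pprod x i < 1
    induction i using Fin.induction with
    | zero => rw [pprod_zero]; exact (hx 0).2
    | succ j ih =>
      rw [pprod_succ]
      calc pprod x j.castSucc * x j.succ < pprod x j.castSucc * 1 :=
            mul_lt_mul_of_pos_left (hx _).2 (hpos _)
        _ < 1 := by rw [mul_one]; exact ih
  · refine Fin.strictAnti_iff_succ_lt.mpr fun j => ?_
    show pprod x j.succ < pprod x j.castSucc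
    rw [pprod_succ]
    exact mul_lt_of_lt_one_right (hpos _) (hx _).2

/-- The successive quotients `(t₀, t₁/t₀, …, t_n/t_{n-1})` of a point of the open ordered
simplex lie in the open cube. [folklore] -/
theorem cons_div_mem_cube {t : Fin (n + 1) → ℝ} (ht : t ∈ simplex (n + 1)) :
    (Fin.cons (t 0) fun j : Fin n => t j.succ / t j.castSucc : Fin (n + 1) → ℝ) ∈
      cube (n + 1) := by
  obtain ⟨h0, h1, hanti⟩ := ht
  intro i
  refine Fin.cases ?_ (fun j => ?_) i
  · rw [Fin.cons_zero]
    exact ⟨h0 0, h1 0⟩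
  · rw [Fin.cons_succ]
    have hlt : t j.succ < t j.castSucc := hanti Fin.castSucc_lt_succ
    exact ⟨div_pos (h0 _) (h0 _), (div_lt_one (h0 _)).mpr hlt⟩

/-- **The cubical chart maps `(0,1)ᴺ` onto the open ordered simplex** (every `N`; for `N = 0`
both are the one-point space). [folklore] -/
theorem image_cubicalMap (N : ℕ) : cubicalMap N '' cube N = simplex N := by
  cases N with
  | zero =>
    ext t
    simp only [simplex_zero, mem_univ, iff_true]
    exact ⟨t, fun i => i.elim0, Subsingleton.elim _ _⟩
  | succ n =>
    apply Subset.antisymm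
    · rintro _ ⟨x, hx, rfl⟩
      exact cubicalMap_mem_simplex hx
    · intro t ht
      exact ⟨_, cons_div_mem_cube ht, cubicalMap_cons_div fun i => (ht.1 i).ne'⟩

/-- The cubical chart is injective on the open cube (successive cancellation). [folklore] -/
theorem injOn_cubicalMap (N : ℕ) : InjOn (cubicalMap N) (cube N) := by
  cases N with
  | zero => exact fun x _ y _ _ => Subsingleton.elim x y
  | succ n =>
    intro x hx y hy h
    have hx0 : ∀ i, x i ≠ 0 := fun i => (hx i).1.ne'
    have hy0 : ∀ i, y i ≠ 0 := fun i => (hy i).1.ne'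
    have h' : ∀ i, pprod x i = pprod y i := fun i => congrFun h i
    funext i
    refine Fin.cases ?_ (fun j => ?_) i
    · rw [← pprod_zero x, ← pprod_zero y, h']
    · rw [eq_pprod_succ_div hx0, eq_pprod_succ_div hy0, h', h']

/-- **The Jacobian of the cubical chart**: the product of the diagonal entries
`∏_{l<i} x_l` of the (lower-triangular) Jacobian matrix `∂tᵢ/∂xⱼ` is `∏ⱼ xⱼ^{N-1-j}` (count, for
each `j`, the `N-1-j` rows `i > j` in which `x_j` occurs). [folklore] -/
theorem prod_prod_erase_filter_le (y : Fin N → ℝ) :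
    ∏ i : Fin N, ∏ k ∈ (Finset.univ.filter (fun j => j ≤ i)).erase i, y k =
      ∏ j : Fin N, y j ^ (N - 1 - (j : ℕ)) := by
  have h1 : ∀ i : Fin N, (Finset.univ.filter (fun j => j ≤ i)).erase i = Finset.Iio i := by
    intro i
    ext k
    simp only [Finset.mem_erase, Finset.mem_filter, Finset.mem_univ, true_and, Finset.mem_Iio,
      lt_iff_le_and_ne, ne_eq, and_comm]
  simp_rw [h1]
  calc ∏ i : Fin N, ∏ k ∈ Finset.Iio i, y k
      = ∏ i : Fin N, ∏ k : Fin N, (if k < i then y k else 1) := by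
        refine Finset.prod_congr rfl fun i _ => ?_
        rw [← Fintype.prod_extend_by_one (Finset.Iio i)]
        simp only [Finset.mem_Iio]
    _ = ∏ k : Fin N, ∏ i : Fin N, (if k < i then y k else 1) := Finset.prod_comm
    _ = ∏ k : Fin N, ∏ i ∈ Finset.Ioi k, y k := by
        refine Finset.prod_congr rfl fun k _ => ?_
        rw [← Fintype.prod_extend_by_one (Finset.Ioi k)]
        simp only [Finset.mem_Ioi]
    _ = ∏ j : Fin N, y j ^ (N - 1 - (j : ℕ)) := by
        simp only [Finset.prod_const, Fin.card_Ioi]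

/-- The Jacobian `∏ⱼ xⱼ^{N-1-j}` is positive on the open cube. [folklore] -/
theorem jacobian_pos {y : Fin N → ℝ} (hy : y ∈ cube N) :
    0 < ∏ j : Fin N, y j ^ (N - 1 - (j : ℕ)) :=
  Finset.prod_pos fun j _ => pow_pos (hy j).1 _

/-- On the open cube the cubical pull-back `cubicalFun ε q` is the word integrand at the chart
times the absolute Jacobian of the monomial chart with rows `{j ≤ i}`. [folklore] -/
theorem cubicalFun_eq_mul_abs_jacobian (ε : Fin N → Bool) (q : ℚ) {y : Fin N → ℝ}
    (hy : y ∈ cube N) :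
    cubicalFun ε q y = wordFun ε q (cubicalMap N y) *
      |∏ i : Fin N, ∏ k ∈ (Finset.univ.filter (fun j => j ≤ i)).erase i, y k| := by
  rw [prod_prod_erase_filter_le, abs_of_pos (jacobian_pos hy)]
  rfl

end Chart

/-! ## The stub -/

/-- **Cubical chart** (stub `stub_cubicalChart` of the line `two-posets-interior-landen`).
For admissible letters `ε` and every `q`, the cubical pull-back `cubicalFun ε q` is absolutely
integrable on the open cube, and the word representation `[Δ_N, q ω_ε]` differs from every
representation on the open cube with that integrand by a relation — ONE change-of-variables
move (Kontsevich–Zagier's rule (2)) along the monomial chart `tᵢ = x₀⋯xᵢ`, a polynomial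
bijection `(0,1)ᴺ → Δ_N` with lower-triangular Jacobian of determinant `∏ⱼ xⱼ^{N-1-j} > 0`;
both conjuncts are instances of the monomial-chart transport theorem
`monomialChart_transport`. Kontsevich–Zagier 2001, §1.2 rule (2). -/
theorem stub_cubicalChart : CubicalChart := by
  intro N ε hε q
  have hS : ∀ i : Fin N, ∀ j ∈ Finset.univ.filter (fun j => j ≤ i), j ≤ i := fun i j hj =>
    (Finset.mem_filter.mp hj).2
  have hS' : ∀ i : Fin N, i ∈ Finset.univ.filter (fun j => j ≤ i) := fun i =>
    Finset.mem_filter.mpr ⟨Finset.mem_univ _, le_rfl⟩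
  have hT := monomialChart_transport (fun i : Fin N => Finset.univ.filter (fun j => j ≤ i))
    hS hS' (isSemialgebraic_cube N)
    (cubicalMap N) (fun _ _ => rfl) (injOn_cubicalMap N) (cubicalFun ε q) (wordFun ε q)
    (fun y hy => cubicalFun_eq_mul_abs_jacobian ε q hy)
  have hdom : (wordRep ε q hε).domain = cubicalMap N '' cube N := by
    rw [wordRep_domain, image_cubicalMap]
  have hint : EqOn (wordRep ε q hε).integrand (wordFun ε q) (wordRep ε q hε).domain :=
    fun _ _ => rfl
  refine ⟨?_, fun r hr hri => ?_⟩
  · obtain ⟨r, hrd, hri⟩ := hT.1 (wordRep ε q hε) hdom hint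
    have h := r.integrableOn
    rwa [hrd, hri] at h
  · exact (hT.2 r (wordRep ε q hε) hr hri hdom hint).symm

end Summit.KontsevichZagierPeriods.MzvKernelInKZ.TwoPosets
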